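import Summits.Ventures.CertifiedArithmetic.LowPrec.DoubleRoundingProductSameQuantumWindow

/-!
# Double rounding at equal quanta: a slip forces the COARSE midpoint window (any register spacing)

HONEST FRAMING (venture CertifiedArithmetic / cell `pub-lowprec`): certified error envelopes and
provably optimal rounding/accumulation schemes for low-precision formats under stated cost models;
every table by two implementations; no hardware or vendor claims.

ONE GRID INSIDE ANOTHER, binade by binade, for a register of ANY precision.  `φ` and `ψ` have the
SAME quantum `q` (`d = 0`), `m = m_φ ≥ 1`, `m_ψ ≥ 1`.  In the binade where `φ` has spacing
`2^(k+1) q` take the cell `[c, c+1]·2^(k+1) q` (`2^m ≤ c < 2^(m+1)`, in range of both formats) and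
`x = (c·2^t + r)·2^(k+1) q / 2^t` (`t ≥ 1` extra bits, `r < 2^t`); suppose the register holds
every multiple of `2^e q` on the cell (`(c+1)·2^(k+1) ≤ 2^(m_ψ+1+e)`, `e ≤ k`, so the corners and
the midpoint `μ = (2c+1)·2^k q` are values of `ψ`) and, if `e ≥ 1`, that `2^e q` is not finer than
the spacing of `ψ` there (`2^(m_ψ+e) ≤ c·2^(k+1)`).  With `2^g` = half of `2^e q` in units of the
last bit of `x` (`e + t = k + 2 + g`), THEOREM (`sameQ_coarse_window_of_roundNE_roundNE_ne`): a
slip `fl_φ (fl_ψ x) ≠ fl_φ x` forces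
`(c even ∧ 2^(t-1) < r ∧ (r < 2^(t-1) + 2^g ∨ (e + 1 ≤ k ∧ r = 2^(t-1) + 2^g))) ∨
 (c odd ∧ r < 2^(t-1) ∧ (2^(t-1) < r + 2^g ∨ (e + 1 ≤ k ∧ r + 2^g = 2^(t-1))))`.
Proof (that of `sameQ_window_of_roundNE_roundNE_ne`, the case `e = 0`, `t = k + 1 + u`, verbatim
on the coarser grid): `fl_ψ x`, within half of `2^e q` of `x`, stays on the side of `μ` where
`fl_φ` is constant unless it IS `μ`; then `fl_φ μ` is the even corner, a slip iff `c` has the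
odd-side parity; at distance exactly half of `2^e q` (a tie of `ψ`) ties-to-even makes the
significand of `μ` in `ψ` even, i.e. `2^(e+1) ∣ (2c+1)·2^k`, `e + 1 ≤ k`.  When `e + t ≤ k + 1`
(no `g`) `x` itself is a value of `ψ` and nothing slips.  This is the pointwise converse behind the
decision for every register precision (`DoubleRoundingProductSameQuantumStripLaw.lean`).
Two implementations: A = `code/enum/mul_sameq_strip_law.py` (window hits = brute-force slips of the
exact-rational odd-parts model at every register gap, `P ≤ 7`) →
`certs/enum/DOUBLE-ROUNDING-MUL-SAMEQ-STRIP.json`; B = this file (structural, every record).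
PLACEMENT — KNOWN: a double-rounding slip forces the intermediate result onto a midpoint of the
target ([MartinDorelMelquiondMuller2013] Property 2.1; [BoldoMelquiond2008] Thm 3;
[Figueroa1995] §2–3).  NEW (modestly): the record-generic window at `d = 0` for a register of any
precision, with the refined tie boundary `e + 1 ≤ k`.  No hardware or vendor claims.
-/

namespace Summit.Ventures.CertifiedArithmetic

open Literature.ComputerArithmetic.FloatingPoint
open Literature.ComputerArithmetic.FloatingPoint.Format
open Literature.ComputerArithmetic.FloatingPoint.MiniFloat

/-! ## §1 A slip forces the coarse window -/

/-- A SLIP FORCES THE COARSE WINDOW (equal quanta, any register spacing; pointwise): `L_ψ = L_φ`,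
`m_φ, m_ψ ≥ 1`; `x = (c·2^t + r)·2^(k+1) q / 2^t` with `t ≥ 1`, `r < 2^t`, `2^m ≤ c < 2^(m+1)`
(the cell `[c, c+1]·2^(k+1) q` of `φ`), `(c+1)·2^(k+1)` in range of both, the register holding
every multiple of `2^e q` on the cell (`(c+1)·2^(k+1) ≤ 2^(m_ψ+1+e)`, `e ≤ k`) with `2^e q` not
finer than its spacing there when `e ≥ 1` (`2^(m_ψ+e) ≤ c·2^(k+1)`), and `e + t = k + 2 + g`:
a slip `fl_φ (fl_ψ x) ≠ fl_φ x` forces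
`(c even ∧ 2^(t-1) < r ∧ (r < 2^(t-1) + 2^g ∨ (e + 1 ≤ k ∧ r = 2^(t-1) + 2^g))) ∨
 (c odd ∧ r < 2^(t-1) ∧ (2^(t-1) < r + 2^g ∨ (e + 1 ≤ k ∧ r + 2^g = 2^(t-1))))`.
[this packet; cite: MartinDorelMelquiondMuller2013, Property 2.1] -/
theorem sameQ_coarse_window_of_roundNE_roundNE_ne {φ ψ : Format} (hq : ψ.qexp = φ.qexp)
    (h1 : 1 ≤ φ.manBits) (h1ψ : 1 ≤ ψ.manBits) {c r t k e g : ℕ} (ht : 1 ≤ t) (he : e ≤ k)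
    (hg : e + t = k + 2 + g) (hr : r < 2 ^ t) (hclo : 2 ^ φ.manBits ≤ c)
    (hchi : c < 2 ^ (φ.manBits + 1)) (hcM : (c + 1) * 2 ^ (k + 1) ≤ φ.maxScaled)
    (hψm : (c + 1) * 2 ^ (k + 1) ≤ 2 ^ (ψ.manBits + 1 + e))
    (hψM : (c + 1) * 2 ^ (k + 1) ≤ ψ.maxScaled)
    (hψe : 1 ≤ e → 2 ^ (ψ.manBits + e) ≤ c * 2 ^ (k + 1))
    (hne : (roundNE φ (roundNE ψ (((c * 2 ^ t + r : ℕ) : ℚ)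
        * φ.quantum * 2 ^ (k + 1) / 2 ^ t)).toRat).toRat
      ≠ (roundNE φ (((c * 2 ^ t + r : ℕ) : ℚ) * φ.quantum * 2 ^ (k + 1) / 2 ^ t)).toRat) :
    (c % 2 = 0 ∧ 2 ^ (t - 1) < r ∧
        (r < 2 ^ (t - 1) + 2 ^ g ∨ (e + 1 ≤ k ∧ r = 2 ^ (t - 1) + 2 ^ g))) ∨
      (c % 2 = 1 ∧ r < 2 ^ (t - 1) ∧
        (2 ^ (t - 1) < r + 2 ^ g ∨ (e + 1 ≤ k ∧ r + 2 ^ g = 2 ^ (t - 1)))) := by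
  have hq0 := φ.quantum_pos
  have hQ : ψ.quantum = φ.quantum := by
    show (2 : ℚ) ^ ψ.qexp = (2 : ℚ) ^ φ.qexp
    rw [hq]
  -- `k = e + a`, `t = a + g + 2` (`n = t - 1 = a + g + 1`)
  obtain ⟨a, rfl⟩ : ∃ a, k = e + a := ⟨k - e, by omega⟩
  obtain rfl : t = a + g + 2 := by omega
  rw [show a + g + 2 - 1 = a + g + 1 by omega]
  rw [show e + 1 ≤ e + a ↔ 1 ≤ a by omega]
  -- the unit `s` = the last bit of `x`; `q = 2^(a+g+2) s / 2^(e+a+1)`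
  set s : ℚ := φ.quantum * 2 ^ (e + a + 1) / 2 ^ (a + g + 2) with hs
  have hs0 : 0 < s := by positivity
  have hqs : φ.quantum = 2 ^ (a + g + 2) * s / 2 ^ (e + a + 1) := by rw [hs]; field_simp
  set x : ℚ := ((c * 2 ^ (a + g + 2) + r : ℕ) : ℚ) * φ.quantum * 2 ^ (e + a + 1)
    / 2 ^ (a + g + 2) with hx
  -- `B = c·2^(k+1) q` (low corner), `H = 2^k q = 2^(a+g+1) s` (half cell), `S = 2^e q = 2^(g+1) s`
  set B : ℚ := (c : ℚ) * 2 ^ (a + g + 2) * s with hB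
  set H : ℚ := (2 : ℚ) ^ (a + g + 1) * s with hH
  have hH0 : 0 < H := by positivity
  have hB0 : 0 ≤ B := by positivity
  have hxs : x = B + (r : ℚ) * s := by
    rw [hx, hB, hqs]; push_cast; field_simp; try ring
  have hV : ((c * 2 ^ (e + a + 1) : ℕ) : ℚ) * φ.quantum = B := by
    rw [hB, hqs]; push_cast; field_simp; try ring
  have hμ : (((2 * c + 1) * 2 ^ (e + a) : ℕ) : ℚ) * φ.quantum = B + H := by
    rw [hB, hH, hqs]; push_cast; field_simp; try ring
  have hV' : (((c + 1) * 2 ^ (e + a + 1) : ℕ) : ℚ) * φ.quantum = B + 2 * H := by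
    rw [hB, hH, hqs]; push_cast; field_simp; try ring
  have e2 : (2 : ℚ) ^ (e + a) * φ.quantum = H := by
    rw [hH, hqs]; field_simp; try ring
  have hS : (2 : ℚ) ^ e * φ.quantum = 2 * (2 ^ g * s) := by
    rw [hqs]; field_simp; try ring
  have hHn : H = (2 : ℚ) ^ (a + g + 1) * s := hH
  have hrs0 : 0 ≤ (r : ℚ) * s := by positivity
  have hr2 : (r : ℚ) < 2 * 2 ^ (a + g + 1) := by
    have : (r : ℚ) < 2 ^ (a + g + 2) := by exact_mod_cast hr
    rw [pow_succ] at this; linarith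
  have hrs2 : (r : ℚ) * s < 2 * H := by
    rw [hH]; have := mul_lt_mul_of_pos_right hr2 hs0; linarith
  -- the values of `φ` at the corners
  obtain ⟨hrV, hrV'⟩ := representable_gmid (φ := φ) (t := c) (k := e + a) hchi hcM
  obtain ⟨vV, hvV⟩ := exists_toRat_eq_natMul hrV
  obtain ⟨vV', hvV'⟩ := exists_toRat_eq_natMul hrV'
  -- the values of `ψ`: every multiple of `2^e q` on the cell
  have hψpt : ∀ i : ℕ, i * 2 ^ e ≤ (c + 1) * 2 ^ (e + a + 1) →
      ∃ z : MiniFloat ψ, z.toRat = ((i * 2 ^ e : ℕ) : ℚ) * φ.quantum := by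
    intro i hi
    obtain ⟨z, hz⟩ := exists_toRat_eq_natMul (representable_of_pow_dvd (φ := ψ) (g := e)
      (n := i * 2 ^ e) ⟨i, by ring⟩ (le_trans hi hψm) (le_trans hi hψM))
    exact ⟨z, by rw [hz, hQ]⟩
  have hpa : 2 ^ (a + 1) * 2 ^ e = 2 ^ (e + a + 1) := by rw [← pow_add]; congr 1; omega
  have hpa' : 2 ^ a * 2 ^ e = 2 ^ (e + a) := by rw [← pow_add]; congr 1; omega
  obtain ⟨zV, hzV⟩ := hψpt (c * 2 ^ (a + 1))
    (by rw [mul_assoc, hpa]; exact Nat.mul_le_mul_right _ (Nat.le_succ c))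
  obtain ⟨zμ, hzμ⟩ := hψpt ((2 * c + 1) * 2 ^ a) (by
    rw [mul_assoc, hpa', show (c + 1) * 2 ^ (e + a + 1) = (2 * c + 2) * 2 ^ (e + a) by ring]
    exact Nat.mul_le_mul_right _ (by omega))
  obtain ⟨zV', hzV'⟩ := hψpt ((c + 1) * 2 ^ (a + 1)) (by rw [mul_assoc, hpa])
  replace hzV : zV.toRat = B := by
    rw [hzV, ← hV]; push_cast; ring
  replace hzμ : zμ.toRat = B + H := by
    rw [hzμ, ← hμ]; push_cast; ring
  replace hzV' : zV'.toRat = B + 2 * H := by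
    rw [hzV', ← hV']; push_cast; ring
  -- `fl_ψ x` is within half of `2^e q`, i.e. `2^g s`, of `x`
  have hdist : |x - (roundNE ψ x).toRat| ≤ 2 ^ g * s := by
    obtain ⟨kk, hk⟩ : ∃ kk, r / 2 ^ (g + 1) = kk := ⟨_, rfl⟩
    obtain ⟨ρ, hρ'⟩ : ∃ ρ, r % 2 ^ (g + 1) = ρ := ⟨_, rfl⟩
    have hρ : r = kk * 2 ^ (g + 1) + ρ := by
      rw [← hk, ← hρ']; exact (Nat.div_add_mod' r (2 ^ (g + 1))).symm
    have hρlt : ρ < 2 ^ (g + 1) := by rw [← hρ']; exact Nat.mod_lt _ (by positivity)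
    have hk1 : kk < 2 ^ (a + 1) := by
      rw [← hk, Nat.div_lt_iff_lt_mul (by positivity), ← pow_add,
        show a + 1 + (g + 1) = a + g + 2 by omega]
      exact hr
    have hg2 : (2 : ℚ) ^ (g + 1) = 2 * 2 ^ g := pow_succ' 2 g
    have hρq : (r : ℚ) = (kk : ℚ) * 2 ^ (g + 1) + ρ := by exact_mod_cast hρ
    have hkk : ∀ j : ℕ, j ≤ 2 ^ (a + 1) →
        (c * 2 ^ (a + 1) + j) * 2 ^ e ≤ (c + 1) * 2 ^ (e + a + 1) := by
      intro j hj
      rw [show (c + 1) * 2 ^ (e + a + 1) = (c * 2 ^ (a + 1) + 2 ^ (a + 1)) * 2 ^ e by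
        rw [← hpa]; ring]
      exact Nat.mul_le_mul_right _ (by omega)
    rcases le_or_gt (ρ * 2) (2 ^ (g + 1)) with hlo | hhi
    · obtain ⟨z, hz⟩ := hψpt (c * 2 ^ (a + 1) + kk) (hkk kk hk1.le)
      refine le_trans (roundNE_nearest (φ := ψ) x z) ?_
      have e : x - z.toRat = (ρ : ℚ) * s := by
        rw [hxs, hz, hB, hρq, hqs]; push_cast; field_simp; ring
      have : (ρ : ℚ) * 2 ≤ 2 ^ (g + 1) := by exact_mod_cast hlo
      rw [e, abs_of_nonneg (by positivity)]; rw [hg2] at this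
      exact mul_le_mul_of_nonneg_right (by linarith) hs0.le
    · obtain ⟨z, hz⟩ := hψpt (c * 2 ^ (a + 1) + (kk + 1)) (hkk (kk + 1) hk1)
      refine le_trans (roundNE_nearest (φ := ψ) x z) ?_
      have e : x - z.toRat = -(((2 ^ (g + 1) - ρ : ℕ) : ℚ) * s) := by
        rw [hxs, hz, hB, hρq, hqs, Nat.cast_sub hρlt.le]; push_cast; field_simp; ring
      have : (((2 ^ (g + 1) - ρ : ℕ)) : ℚ) * 2 ≤ 2 ^ (g + 1) := by
        exact_mod_cast (by omega : (2 ^ (g + 1) - ρ) * 2 ≤ 2 ^ (g + 1))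
      rw [e, abs_neg, abs_of_nonneg (by positivity)]; rw [hg2] at this
      exact mul_le_mul_of_nonneg_right (by linarith) hs0.le
  -- `fl_φ` is constant on each half-cell (projection at the corners, the gap around `μ` inside)
  have hflV : (roundNE φ B).toRat = B := by rw [← hV, ← hvV, toRat_roundNE_toRat]
  have hflV' : (roundNE φ (B + 2 * H)).toRat = B + 2 * H := by
    rw [← hV', ← hvV', toRat_roundNE_toRat]
  have hlow : ∀ y : ℚ, B ≤ y → y < B + H → (roundNE φ y).toRat = B := by
    intro y hy1 hy2
    rcases eq_or_lt_of_le hy1 with hy | hy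
    · rw [← hy]; exact hflV
    · have hδ0 : 0 < (((2 * c + 1) * 2 ^ (e + a) : ℕ) : ℚ) * φ.quantum - y := by
        rw [hμ]; linarith
      have hδ : (((2 * c + 1) * 2 ^ (e + a) : ℕ) : ℚ) * φ.quantum - y
          < 2 ^ (e + a) * φ.quantum := by rw [e2, hμ]; linarith
      have ey : y = (((2 * c + 1) * 2 ^ (e + a) : ℕ) : ℚ) * φ.quantum
          - ((((2 * c + 1) * 2 ^ (e + a) : ℕ) : ℚ) * φ.quantum - y) := by ring
      rw [ey, toRat_roundNE_below_gmid hclo hchi hcM hδ0 hδ, hV]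
  have hhigh : ∀ y : ℚ, B + H < y → y ≤ B + 2 * H → (roundNE φ y).toRat = B + 2 * H := by
    intro y hy1 hy2
    rcases eq_or_lt_of_le hy2 with hy | hy
    · rw [hy]; exact hflV'
    · have hδ0 : 0 < y - (((2 * c + 1) * 2 ^ (e + a) : ℕ) : ℚ) * φ.quantum := by
        rw [hμ]; linarith
      have hδ : y - (((2 * c + 1) * 2 ^ (e + a) : ℕ) : ℚ) * φ.quantum
          < 2 ^ (e + a) * φ.quantum := by rw [e2, hμ]; linarith
      have ey : y = (((2 * c + 1) * 2 ^ (e + a) : ℕ) : ℚ) * φ.quantum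
          + (y - (((2 * c + 1) * 2 ^ (e + a) : ℕ) : ℚ) * φ.quantum) := by ring
      rw [ey, toRat_roundNE_above_gmid hclo hchi hcM hδ0 hδ, hV']
  -- the parity of the significand of `μ` in `ψ` after a tie: `2^(e+1) ∣ (2c+1)·2^(e+a)`, `a ≥ 1`
  have hpar : (roundNE ψ x).toRat = B + H → 2 ∣ (roundNE ψ x).man → 1 ≤ a := by
    intro heq hev
    have heqψ : (roundNE ψ x).toRat = (((2 * c + 1) * 2 ^ (e + a) : ℕ) : ℚ) * ψ.quantum := by
      rw [hQ, hμ]; exact heq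
    rw [two_dvd_man_iff h1ψ, scaledMag_eq_of_toRat_eq heqψ] at hev
    by_contra ha0
    obtain rfl : a = 0 := by omega
    simp only [add_zero] at hev heqψ hψe
    -- `2^(e+1) ∣ (2c+1)·2^e`
    have h3 : 2 ^ (e + 1) ∣ (2 * c + 1) * 2 ^ e := by
      rcases Nat.eq_zero_or_pos e with he0 | he1
      · subst he0
        obtain ⟨w, hw⟩ := hev
        exact ⟨2 ^ ((roundNE ψ x).expCode - 1) * w, by rw [hw]; ring⟩
      · have hle : 2 ^ (ψ.manBits + 1 + (e - 1)) ≤ (roundNE ψ x).scaledMag := by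
          rw [scaledMag_eq_of_toRat_eq heqψ, show ψ.manBits + 1 + (e - 1) = ψ.manBits + e by omega]
          calc 2 ^ (ψ.manBits + e) ≤ c * 2 ^ (e + 1) := hψe he1
            _ ≤ (2 * c + 1) * 2 ^ e := by
                rw [pow_succ]; nlinarith [Nat.one_le_two_pow (n := e)]
        have hE := succ_le_ulpExp_of_le_scaledMag hle
        obtain ⟨j, hj⟩ := Nat.exists_eq_add_of_le (show e ≤ (roundNE ψ x).expCode - 1 by omega)
        refine dvd_trans ⟨2 ^ j, ?_⟩ hev
        rw [hj, pow_add, pow_succ]; ring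
    obtain ⟨y, hy⟩ := h3
    have h4 : 2 ^ e * (2 * c + 1) = 2 ^ e * (2 * y) := by
      rw [mul_comm (2 ^ e), hy, pow_succ]; ring
    have h5 := Nat.eq_of_mul_eq_mul_left (by positivity) h4
    omega
  -- case analysis on the position of `x` in its cell
  rcases lt_trichotomy r (2 ^ (a + g + 1)) with hrn | hrn | hrn
  · -- below the midpoint: `fl_φ x = B`, `fl_ψ x ∈ [B, μ]`
    right
    have hrns : (r : ℚ) * s < H := by
      rw [hH]; exact mul_lt_mul_of_pos_right (by exact_mod_cast hrn) hs0
    have hx1 : B ≤ x := by rw [hxs]; linarith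
    have hx2 : x < B + H := by rw [hxs]; linarith
    have hfx : (roundNE φ x).toRat = B := hlow x hx1 hx2
    have hy1 : B ≤ (roundNE ψ x).toRat := by
      have := toRat_roundNE_mono (φ := ψ) hx1
      rwa [← hzV, toRat_roundNE_toRat, hzV] at this
    have hy2 : (roundNE ψ x).toRat ≤ B + H := by
      have := toRat_roundNE_mono (φ := ψ) hx2.le
      rwa [← hzμ, toRat_roundNE_toRat, hzμ] at this
    rcases lt_or_eq_of_le hy2 with hlt | heq
    · exact absurd ((hlow _ hy1 hlt).trans hfx.symm) hne
    · -- `fl_ψ x = μ`: distance, parity of `c`, and the refined boundary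
      have hd2 : ((2 : ℚ) ^ (a + g + 1) - r) * s ≤ 2 ^ g * s := by
        have := hdist
        rwa [heq, hxs, hH, show B + (r : ℚ) * s - (B + 2 ^ (a + g + 1) * s)
          = -((2 ^ (a + g + 1) - r) * s) by ring, abs_neg,
          abs_of_nonneg (mul_nonneg (sub_nonneg.2 (by exact_mod_cast hrn.le)) hs0.le)] at this
      have hd3 : (2 : ℚ) ^ (a + g + 1) - r ≤ 2 ^ g := le_of_mul_le_mul_right hd2 hs0
      have hd2' : 2 ^ (a + g + 1) ≤ r + 2 ^ g := by
        have h' : ((2 ^ (a + g + 1) : ℕ) : ℚ) ≤ ((r + 2 ^ g : ℕ) : ℚ) := by push_cast; linarith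
        exact_mod_cast h'
      have hcodd : c % 2 = 1 := by
        by_contra hc
        have := toRat_roundNE_gmid (k := e + a) h1 (Nat.even_iff.mpr (by omega)) hclo hchi hcM
        rw [hμ, ← heq, hV] at this
        exact hne (this.trans hfx.symm)
      refine ⟨hcodd, hrn, ?_⟩
      rcases lt_or_eq_of_le hd2' with hlt' | heq'
      · exact Or.inl hlt'
      · refine Or.inr ⟨?_, heq'.symm⟩
        -- `x` is a tie of `ψ` between `μ - 2^e q` and `μ`: ties-to-even
        have hNpos : 1 ≤ (2 * c + 1) * 2 ^ a := Nat.one_le_iff_ne_zero.mpr (by positivity)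
        obtain ⟨zlo, hzlo⟩ := hψpt ((2 * c + 1) * 2 ^ a - 1) (by
          have : ((2 * c + 1) * 2 ^ a - 1) * 2 ^ e ≤ ((2 * c + 1) * 2 ^ a) * 2 ^ e :=
            Nat.mul_le_mul_right _ (Nat.sub_le _ _)
          refine le_trans this ?_
          rw [mul_assoc, hpa', show (c + 1) * 2 ^ (e + a + 1) = (2 * c + 2) * 2 ^ (e + a) by ring]
          exact Nat.mul_le_mul_right _ (by omega))
        have hr' : (r : ℚ) = 2 ^ (a + g + 1) - 2 ^ g := by
          have e1 : ((2 ^ (a + g + 1) : ℕ) : ℚ) = ((r + 2 ^ g : ℕ) : ℚ) := by rw [heq']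
          push_cast at e1; linarith
        have hzlo' : zlo.toRat = B + H - 2 * (2 ^ g * s) := by
          rw [hzlo, Nat.cast_mul, Nat.cast_sub hNpos, ← hS, ← hμ]; push_cast; ring
        have hxlo : x - zlo.toRat = 2 ^ g * s := by rw [hzlo', hxs, hr', hH]; ring
        have hxμ : x - (roundNE ψ x).toRat = -(2 ^ g * s) := by rw [heq, hxs, hr', hH]; ring
        have htie : |x - zlo.toRat| = |x - (roundNE ψ x).toRat| := by rw [hxlo, hxμ, abs_neg]
        have hne2 : zlo.toRat ≠ (roundNE ψ x).toRat := by
          rw [hzlo', heq]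
          have : (0 : ℚ) < 2 ^ g * s := by positivity
          linarith
        exact hpar heq (roundNE_man_even_of_tie h1ψ htie hne2)
  · -- `x` is the midpoint itself, a value of `ψ`: no slip
    exact absurd (toRat_roundNE_roundNE_of_exists ⟨zμ, by rw [hzμ, hxs, hrn, hH]; push_cast; ring⟩)
      hne
  · -- above the midpoint: `fl_φ x = B + 2H`, `fl_ψ x ∈ [μ, B + 2H]`
    left
    have hrns : H < (r : ℚ) * s := by
      rw [hH]; exact mul_lt_mul_of_pos_right (by exact_mod_cast hrn) hs0
    have hx1 : B + H < x := by rw [hxs]; linarith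
    have hx2 : x ≤ B + 2 * H := by rw [hxs]; linarith
    have hfx : (roundNE φ x).toRat = B + 2 * H := hhigh x hx1 hx2
    have hy1 : B + H ≤ (roundNE ψ x).toRat := by
      have := toRat_roundNE_mono (φ := ψ) hx1.le
      rwa [← hzμ, toRat_roundNE_toRat, hzμ] at this
    have hy2 : (roundNE ψ x).toRat ≤ B + 2 * H := by
      have := toRat_roundNE_mono (φ := ψ) hx2
      rwa [← hzV', toRat_roundNE_toRat, hzV'] at this
    rcases lt_or_eq_of_le hy1 with hlt | heq
    · exact absurd ((hhigh _ hlt hy2).trans hfx.symm) hne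
    · have hd2 : ((r : ℚ) - 2 ^ (a + g + 1)) * s ≤ 2 ^ g * s := by
        have := hdist
        rwa [← heq, hxs, hH, show B + (r : ℚ) * s - (B + 2 ^ (a + g + 1) * s)
          = (r - 2 ^ (a + g + 1)) * s by ring,
          abs_of_nonneg (mul_nonneg (sub_nonneg.2 (by exact_mod_cast hrn.le)) hs0.le)] at this
      have hd3 : (r : ℚ) - 2 ^ (a + g + 1) ≤ 2 ^ g := le_of_mul_le_mul_right hd2 hs0
      have hd2' : r ≤ 2 ^ (a + g + 1) + 2 ^ g := by
        have h' : (r : ℚ) ≤ ((2 ^ (a + g + 1) + 2 ^ g : ℕ) : ℚ) := by push_cast; linarith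
        exact_mod_cast h'
      have hceven : c % 2 = 0 := by
        by_contra hc
        have := toRat_roundNE_gmid_odd (k := e + a) h1 (Nat.odd_iff.mpr (by omega)) hclo hchi hcM
        rw [hμ, heq, hV'] at this
        exact hne (this.trans hfx.symm)
      refine ⟨hceven, hrn, ?_⟩
      rcases lt_or_eq_of_le hd2' with hlt' | heq'
      · exact Or.inl hlt'
      · refine Or.inr ⟨?_, heq'⟩
        -- `x` is a tie of `ψ` between `μ` and `μ + 2^e q`: ties-to-even
        obtain ⟨zhi, hzhi⟩ := hψpt ((2 * c + 1) * 2 ^ a + 1) (by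
          rw [show (c + 1) * 2 ^ (e + a + 1) = ((2 * c + 1) * 2 ^ a + 2 ^ a) * 2 ^ e by
            rw [← hpa]; ring]
          exact Nat.mul_le_mul_right _ (by have : 1 ≤ 2 ^ a := Nat.one_le_two_pow; omega))
        have hr' : (r : ℚ) = 2 ^ (a + g + 1) + 2 ^ g := by exact_mod_cast heq'
        have hzhi' : zhi.toRat = B + H + 2 * (2 ^ g * s) := by
          rw [hzhi, ← hS, ← hμ]; push_cast; ring
        have hxhi : x - zhi.toRat = -(2 ^ g * s) := by rw [hzhi', hxs, hr', hH]; ring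
        have hxμ : x - (roundNE ψ x).toRat = 2 ^ g * s := by rw [← heq, hxs, hr', hH]; ring
        have htie : |x - zhi.toRat| = |x - (roundNE ψ x).toRat| := by rw [hxhi, hxμ, abs_neg]
        have hne2 : zhi.toRat ≠ (roundNE ψ x).toRat := by
          rw [hzhi', ← heq]
          have : (0 : ℚ) < 2 ^ g * s := by positivity
          linarith
        exact hpar heq.symm (roundNE_man_even_of_tie h1ψ htie hne2)

end Summit.Ventures.CertifiedArithmetic
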